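import Mathlib
import Summits.ValiantsHypothesis.ValiantsHypothesis.Theorems.GrenetZeonPolySizeQPAlgebraCornerFourGlue
import HarnessLib

/-!
# Crux `GrenetZeon.PolySizeQPAlgebra` (stmt-ValiantsHypothesis-8064), line `vbp-slice-dealg` —
# every point `(n, s)` of the `c = 1` box ⟸ a TYPE-INDEPENDENT local Hessian bound + a good `(s+1)`-space

The hand's chain proved the rung reductions for curvilinear local pieces (`…JetHessian`, `…CornerThree`,
`…CornerFour`).  Exact computations (hand folder `calc/jet_general.py`) show that the Hessian law at a point
where `det L` vanishes in the local algebra is the SAME, `2·dim(R)·n - dim(R)(dim(R)-1)`, for every local type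
tested (curvilinear or not, dimensions `3, 4, 5`).  This file makes the resulting picture a theorem BY NAME,
with the type-independent bound as an explicit hypothesis (its shape, inlined, no definition):

  `LocalHessianBound n`: for every finite-dimensional commutative `ℂ`-algebra `R` with a character `φ` of
  nilpotent kernel and a nondegenerate functional `λ`, every `n × n` matrix `A` of LINEAR forms over `R`
  reading a polynomial `F = λ(det A)` coefficientwise, and every point `p` with `det A(p) = 0` IN `R`:
  `rank Hess F(p) ≤ 2 · dim R · n`.

* `exists_piece_equations` — for one local piece `(R, φ, λ, A, F)`: `dim R - 1` polynomials over `ℂ` (the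
  `ker λ`-coordinates of `det A`), vanishing at the origin, such that at any common zero `p` of them with
  `F(p) = 0` one has `det A(p) = 0` in `R` — hence, under `LocalHessianBound n`, `rank Hess F(p) ≤ 2·dim R·n`.
* `not_hasAlgDetRepr_perPoly_self_of_localHessianBound` — **`LocalHessianBound n` and a good `c`-space with
  `s < c` and threshold `t ≥ 2sn` (`n ≥ 1`) give `¬ HasAlgDetRepr per_n n s`**: homogeneous local Frobenius
  normal form, `Σ_i (dim R_i - 1) + (#pieces - 1) ≤ s - 1` equations besides `per_n`, the space criterion,
  and the rank budget `Σ_i 2·dim R_i·n ≤ 2sn`.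
* `corner_all_large_of_localHessianBound` — the all-large-`n` form for every fixed `s`.

So the `m = n` half of the `c = 1` box, for `s < n/2` (threshold `2sn < n²`), reduces to TWO named inputs:
the local Hessian bound (proved in the tree for `dim R ≤ 3` and all curvilinear types, `rank_hess0_jet_le`;
numerically exact in general) and good `(s+1)`-spaces with linear thresholds (design: `k × k` circulant cores
`⊗ J_p`, `k` prime, hand memo).  HONEST FRAMING: a conditional reduction; no stub is closed; VP ≠ VNP is not moved.
-/

noncomputable section

open MvPolynomial Matrix
open Literature.Computability.AlgebraicComplexity

-- single-conjunct layout `Summits/ValiantsHypothesis/ValiantsHypothesis`: duplicated namespace by design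
set_option linter.dupNamespace false

namespace Summit.ValiantsHypothesis.ValiantsHypothesis.Theorems.GrenetZeonPolySizeQPAlgebra

open Summit.ValiantsHypothesis.ValiantsHypothesis.Cruxes.TwoDimCoefficients.DimTwoCases
  (coeff_sum_monomial_support)

section Pieces

variable {σ : Type*} {R : Type*} [CommRing R] [Algebra ℂ R]

/-- Evaluating the coordinate projection `Σ_{d ∈ supp q} ψ(q_d) x^d` at a point `p` gives `ψ` of the value of
`q` at `p` (computed in `R`). [folklore] -/
theorem eval_sum_monomial_support_eq (ψ : R →ₗ[ℂ] ℂ) (q : MvPolynomial σ R) (p : σ → ℂ) :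
    eval p (∑ d ∈ q.support, monomial d (ψ (q.coeff d))) =
      ψ (eval (fun i => algebraMap ℂ R (p i)) q) := by
  classical
  rw [map_sum]
  conv_rhs => rw [q.as_sum, map_sum, map_sum]
  refine Finset.sum_congr rfl fun d _ => ?_
  rw [eval_monomial, eval_monomial, Finsupp.prod, Finsupp.prod]
  have hprod : (∏ i ∈ d.support, (algebraMap ℂ R (p i)) ^ d i) =
      algebraMap ℂ R (∏ i ∈ d.support, p i ^ d i) := by
    rw [map_prod]
    exact Finset.prod_congr rfl fun i _ => by rw [map_pow]
  rw [hprod, mul_comm (q.coeff d), ← Algebra.smul_def, map_smul, smul_eq_mul, mul_comm]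

/-- The value at `p` of a matrix of polynomials over `R`, entrywise; its determinant is the value of the
determinant. [folklore] -/
theorem det_map_eval_eq {m : ℕ} (A : Matrix (Fin m) (Fin m) (MvPolynomial σ R)) (p : σ → ℂ) :
    (A.map (eval (fun i => algebraMap ℂ R (p i)))).det =
      eval (fun i => algebraMap ℂ R (p i)) A.det := by
  rw [← RingHom.mapMatrix_apply, ← RingHom.map_det]

/-- A matrix of linear forms vanishes at the origin, and so does its determinant (positive size). [folklore] -/
theorem eval_zero_det_eq_zero_of_isHomogeneous_one {m : ℕ} (hm : 1 ≤ m)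
    (A : Matrix (Fin m) (Fin m) (MvPolynomial σ R)) (hA : ∀ a b, (A a b).IsHomogeneous 1) :
    eval (fun i => algebraMap ℂ R ((0 : σ → ℂ) i)) A.det = 0 := by
  have h0 : (fun i => algebraMap ℂ R ((0 : σ → ℂ) i)) = 0 := by
    funext i; simp
  rw [h0, MvPolynomial.eval_zero]
  exact constantCoeff_det_eq_zero_of_isHomogeneous_one hm A hA

variable [Module.Finite ℂ R]

/-- **Equations of one local piece.** For a piece `(R, λ, A, F)` (`λ` nondegenerate, `A` linear of positive size,
`F = λ(det A)` coefficientwise) there are `dim R - 1` polynomials over `ℂ` — the coordinates of `det A` along a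
basis of `ker λ`, after the projection `r ↦ r - λ(r)·e` (`λ(e) = 1`) — which vanish at the origin, such that at
every common zero `p` of them with `F(p) = 0` the value `det A(p) ∈ R` vanishes; moreover
`F(p) = λ(det A(p))` for every `p`. [folklore] -/
theorem exists_piece_equations [Nontrivial R] {m : ℕ} (hm : 1 ≤ m) (l : R →ₗ[ℂ] ℂ)
    (hl : ∀ r : R, (∀ x, l (x * r) = 0) → r = 0)
    (A : Matrix (Fin m) (Fin m) (MvPolynomial σ R)) (hA : ∀ a b, (A a b).IsHomogeneous 1)
    (F : MvPolynomial σ ℂ) (hF : ∀ d, l (coeff d A.det) = coeff d F) :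
    ∃ (k : ℕ) (g : Fin k → MvPolynomial σ ℂ), k + 1 ≤ Module.finrank ℂ R ∧
      (∀ j, eval 0 (g j) = 0) ∧ eval 0 F = 0 ∧
      (∀ p : σ → ℂ, eval p F = l (eval (fun i => algebraMap ℂ R (p i)) A.det)) ∧
      ∀ p : σ → ℂ, (∀ j, eval p (g j) = 0) → eval p F = 0 →
        eval (fun i => algebraMap ℂ R (p i)) A.det = 0 := by
  classical
  -- an element `e` with `λ e = 1`, the kernel `K` and the projection onto it
  obtain ⟨e₀, he₀⟩ : ∃ e₀ : R, l e₀ ≠ 0 := by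
    by_contra hnone
    push Not at hnone
    have h1 : (1 : R) = 0 := hl 1 fun x => hnone _
    exact one_ne_zero h1
  set e : R := (l e₀)⁻¹ • e₀ with he
  have hle : l e = 1 := by rw [he, map_smul, smul_eq_mul, inv_mul_cancel₀ he₀]
  set K : Submodule ℂ R := LinearMap.ker l with hK
  -- the projection `P r = r - λ(r) e` into `K`
  have hPmem : ∀ r : R, r - l r • e ∈ K := fun r => by
    rw [hK, LinearMap.mem_ker, map_sub, map_smul, hle, smul_eq_mul, mul_one, sub_self]
  set P : R →ₗ[ℂ] K :=
    LinearMap.codRestrict K (LinearMap.id - (LinearMap.lsmul ℂ R).flip e ∘ₗ l) (fun r => by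
      simpa using hPmem r) with hP
  have hPval : ∀ r : R, ((P r : K) : R) = r - l r • e := fun r => by
    simp [hP]
  -- a basis of `K` and the coordinates
  set bK := Module.finBasis ℂ K with hbK
  set k : ℕ := Module.finrank ℂ K with hk
  set c : Fin k → (R →ₗ[ℂ] ℂ) := fun j => (bK.coord j) ∘ₗ P with hc
  -- dimension count
  have hdim : k + 1 ≤ Module.finrank ℂ R := by
    have hsurj : LinearMap.range l = ⊤ := by
      rw [LinearMap.range_eq_top]
      intro z
      exact ⟨z • e, by rw [map_smul, hle, smul_eq_mul, mul_one]⟩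
    have h := LinearMap.finrank_range_add_finrank_ker l
    rw [hsurj, finrank_top, Module.finrank_self] at h
    rw [hk, hK]; omega
  -- zero detection
  have hzero : ∀ r : R, (∀ j, c j r = 0) → l r = 0 → r = 0 := by
    intro r hcr hlr
    have hPr : (P r : K) = 0 := by
      refine bK.ext_elem fun j => ?_
      rw [map_zero, Finsupp.zero_apply]
      have := hcr j
      rw [hc] at this
      simpa using this
    have h1 := hPval r
    rw [hPr, hlr, zero_smul, sub_zero, Submodule.coe_zero] at h1
    exact h1.symm
  -- the equations and `F` as coordinate projections of `det A`
  set g : Fin k → MvPolynomial σ ℂ := fun j =>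
    ∑ d ∈ A.det.support, monomial d (c j (A.det.coeff d)) with hg
  have hFsum : F = ∑ d ∈ A.det.support, monomial d (l (A.det.coeff d)) := by
    refine MvPolynomial.ext _ _ fun d => ?_
    rw [coeff_sum_monomial_support]
    split_ifs with hd
    · exact (hF d).symm
    · rw [← hF d, notMem_support_iff.1 hd, map_zero]
  have hFeval : ∀ p : σ → ℂ, eval p F = l (eval (fun i => algebraMap ℂ R (p i)) A.det) := fun p => by
    rw [hFsum, eval_sum_monomial_support_eq]
  have hgeval : ∀ (p : σ → ℂ) j, eval p (g j) = c j (eval (fun i => algebraMap ℂ R (p i)) A.det) :=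
    fun p j => by rw [hg, eval_sum_monomial_support_eq]
  refine ⟨k, g, hdim, fun j => ?_, ?_, hFeval, fun p hgp hFp => ?_⟩
  · rw [hgeval, eval_zero_det_eq_zero_of_isHomogeneous_one hm A hA, map_zero]
  · rw [hFeval, eval_zero_det_eq_zero_of_isHomogeneous_one hm A hA, map_zero]
  · refine hzero _ (fun j => ?_) ?_
    · rw [← hgeval]; exact hgp j
    · rw [← hFeval]; exact hFp

end Pieces

/-! ### The reduction for every `s` -/

section Reduction

/-- **Every point `(n, s)` from the type-independent local Hessian bound and a good `(s+1)`-space.**  Assume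
(`LocalHessianBound n`, inlined): for every finite-dimensional commutative `ℂ`-algebra `R` with a character of
nilpotent kernel and a nondegenerate functional `λ`, every `n × n` matrix `A` of linear forms over `R` with
`F = λ(det A)` coefficientwise, and every point `p` with `det A(p) = 0` in `R`, `rank Hess F(p) ≤ 2·dim R·n`.
Then a good `c`-space with `s < c` and threshold `t ≥ 2sn` at `n ≥ 1` excludes every `(n, s)`-representation of
`per_n`. [cite: MignonRessayre2004, §2] -/
theorem not_hasAlgDetRepr_perPoly_self_of_localHessianBound {n s c t : ℕ} (hn : 1 ≤ n)
    (hH : ∀ (R : Type) [CommRing R] [Algebra ℂ R] [Module.Finite ℂ R] (φ : R →ₐ[ℂ] ℂ) (ν : ℕ),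
      RingHom.ker (φ : R →+* ℂ) ^ ν = ⊥ →
      ∀ (l : R →ₗ[ℂ] ℂ), (∀ r : R, (∀ x, l (x * r) = 0) → r = 0) →
      ∀ (A : Matrix (Fin n) (Fin n) (MvPolynomial (Fin n × Fin n) R)) (F : MvPolynomial (Fin n × Fin n) ℂ),
        (∀ a b, (A a b).IsHomogeneous 1) → (∀ d, l (coeff d A.det) = coeff d F) →
        ∀ p : Fin n × Fin n → ℂ, eval (fun i => algebraMap ℂ R (p i)) A.det = 0 →
          (hess0 (transl p F)).rank ≤ 2 * Module.finrank ℂ R * n)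
    (hW : ∃ w : Fin c → (Fin n × Fin n → ℂ), LinearIndependent ℂ w ∧
      ∀ a : Fin c → ℂ, a ≠ 0 → eval (∑ i, a i • w i) (perPoly (Fin n) ℂ) = 0 →
        t < (hess0 (transl (∑ i, a i • w i) (perPoly (Fin n) ℂ))).rank)
    (hsc : s < c) (ht : 2 * s * n ≤ t) : ¬ HasAlgDetRepr (perPoly (Fin n) ℂ) n s := by
  classical
  intro h
  obtain ⟨q, F, dim, -, hdim, hper, -, hloc⟩ := exists_homogeneous_local_frobenius_perPoly h
  -- per-piece data: equations, dimension count, vanishing at `0`, and the rank bound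
  have key : ∀ i : Fin q, ∃ (k : ℕ) (g : Fin k → MvPolynomial (Fin n × Fin n) ℂ),
      k + 1 ≤ dim i ∧ (∀ j, eval 0 (g j) = 0) ∧ eval 0 (F i) = 0 ∧
        ∀ p : Fin n × Fin n → ℂ, (∀ j, eval p (g j) = 0) → eval p (F i) = 0 →
          (hess0 (transl p (F i))).rank ≤ 2 * dim i * n := by
    intro i
    obtain ⟨R, _, _, _, φ, hker, hdimR, l, A, hA, hcoeff, hnondeg⟩ := hloc i
    haveI : Nontrivial R := ⟨⟨1, 0, fun h10 => one_ne_zero ((map_one φ).symm.trans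
      (by rw [h10, map_zero]))⟩⟩
    obtain ⟨k, g, hk, hg0, hF0, -, hzero⟩ := exists_piece_equations hn l hnondeg A hA (F i) hcoeff
    refine ⟨k, g, by rw [← hdimR]; exact hk, hg0, hF0, fun p hgp hFp => ?_⟩
    rw [← hdimR]
    exact hH R φ s hker l hnondeg A (F i) hA hcoeff p (hzero p hgp hFp)
  choose k g hk hg0 hF0 hrank using key
  cases q with
  | zero =>
    rw [Fintype.sum_empty] at hper
    exact perPoly_ne_zero (Fin n) ℂ hper
  | succ q' =>
    set u₁ : Fin (q' + 1) := Fin.last q' with hu₁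
    set G₁ : Finset (MvPolynomial (Fin n × Fin n) ℂ) := (Finset.univ.erase u₁).image F with hG₁
    set G₂ : Finset (MvPolynomial (Fin n × Fin n) ℂ) :=
      Finset.univ.biUnion fun i => Finset.univ.image (g i) with hG₂
    set G : Finset (MvPolynomial (Fin n × Fin n) ℂ) := G₁ ∪ G₂ with hG
    have hsumk : ∑ i : Fin (q' + 1), k i + (q' + 1) ≤ ∑ i, dim i := by
      have h1 : ∑ i : Fin (q' + 1), (k i + 1) ≤ ∑ i, dim i := Finset.sum_le_sum fun i _ => hk i
      rw [Finset.sum_add_distrib, Finset.sum_const, Finset.card_univ, Fintype.card_fin, smul_eq_mul,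
        mul_one] at h1
      exact h1
    have hGcard : G.card + 1 < c := by
      have h1 : G₁.card ≤ q' := by
        refine Finset.card_image_le.trans ?_
        rw [Finset.card_erase_of_mem (Finset.mem_univ _), Finset.card_univ, Fintype.card_fin]
        omega
      have h2 : G₂.card ≤ ∑ i, k i := by
        refine Finset.card_biUnion_le.trans (Finset.sum_le_sum fun i _ => ?_)
        exact Finset.card_image_le.trans (by rw [Finset.card_univ, Fintype.card_fin])
      have h3 : G.card ≤ G₁.card + G₂.card := Finset.card_union_le _ _
      omega
    have hne : ∃ p : Fin n × Fin n → ℂ, eval p (perPoly (Fin n) ℂ) = 0 ∧ ∀ γ ∈ G, eval p γ = 0 := by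
      refine ⟨0, ?_, fun γ hγ => ?_⟩
      · rw [hper, map_sum]
        exact Finset.sum_eq_zero fun i _ => hF0 i
      · rcases Finset.mem_union.1 hγ with hγ | hγ
        · obtain ⟨i, -, rfl⟩ := Finset.mem_image.1 hγ
          exact hF0 i
        · obtain ⟨i, -, hi⟩ := Finset.mem_biUnion.1 hγ
          obtain ⟨j, -, rfl⟩ := Finset.mem_image.1 hi
          exact hg0 i j
    obtain ⟨p, hpper, hpG, hprank⟩ := spaceCriterion hW G hGcard hne
    have hFu : ∀ i, i ≠ u₁ → eval p (F i) = 0 := fun i hi =>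
      hpG _ (Finset.mem_union_left _ (Finset.mem_image.2
        ⟨i, Finset.mem_erase.2 ⟨hi, Finset.mem_univ _⟩, rfl⟩))
    have hFall : ∀ i, eval p (F i) = 0 := by
      intro i
      by_cases hi : i = u₁
      · have hp := hpper
        rw [hper, map_sum, Finset.sum_eq_single u₁ (fun v _ hv => hFu v hv)
          (fun h' => absurd (Finset.mem_univ _) h')] at hp
        rw [hi]; exact hp
      · exact hFu i hi
    have hgall : ∀ i j, eval p (g i j) = 0 := fun i j =>
      hpG _ (Finset.mem_union_right _ (Finset.mem_biUnion.2
        ⟨i, Finset.mem_univ _, Finset.mem_image.2 ⟨j, Finset.mem_univ _, rfl⟩⟩))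
    have hle : (hess0 (transl p (perPoly (Fin n) ℂ))).rank ≤ 2 * s * n := by
      rw [hper, map_sum, map_sum]
      refine (rank_sum_le _ _).trans ?_
      calc ∑ i, (hess0 (transl p (F i))).rank ≤ ∑ i, 2 * dim i * n :=
            Finset.sum_le_sum fun i _ => hrank i p (hgall i) (hFall i)
        _ = 2 * (∑ i, dim i) * n := by rw [Finset.mul_sum, Finset.sum_mul]
        _ ≤ 2 * s * n := by
            exact Nat.mul_le_mul_right _ (Nat.mul_le_mul_left _ hdim)
    omega

/-- **All large `n`, every fixed `s`:** the local Hessian bound at every `n` and good `(s+1)`-spaces with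
threshold `2sn` for all large `n` empty the point `(n, s)` — and by monotonicity the whole column
`(m, s') ≤ (n, s)` — of the `c = 1` box for all large `n`. [folklore] -/
theorem corner_all_large_of_localHessianBound (s : ℕ)
    (hH : ∀ n : ℕ, ∀ (R : Type) [CommRing R] [Algebra ℂ R] [Module.Finite ℂ R] (φ : R →ₐ[ℂ] ℂ) (ν : ℕ),
      RingHom.ker (φ : R →+* ℂ) ^ ν = ⊥ →
      ∀ (l : R →ₗ[ℂ] ℂ), (∀ r : R, (∀ x, l (x * r) = 0) → r = 0) →
      ∀ (A : Matrix (Fin n) (Fin n) (MvPolynomial (Fin n × Fin n) R)) (F : MvPolynomial (Fin n × Fin n) ℂ),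
        (∀ a b, (A a b).IsHomogeneous 1) → (∀ d, l (coeff d A.det) = coeff d F) →
        ∀ p : Fin n × Fin n → ℂ, eval (fun i => algebraMap ℂ R (p i)) A.det = 0 →
          (hess0 (transl p F)).rank ≤ 2 * Module.finrank ℂ R * n)
    (hW : ∃ n₀ : ℕ, ∀ n ≥ n₀, ∃ w : Fin (s + 1) → (Fin n × Fin n → ℂ), LinearIndependent ℂ w ∧
      ∀ a : Fin (s + 1) → ℂ, a ≠ 0 → eval (∑ i, a i • w i) (perPoly (Fin n) ℂ) = 0 →
        2 * s * n < (hess0 (transl (∑ i, a i • w i) (perPoly (Fin n) ℂ))).rank) :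
    ∃ n₀ : ℕ, ∀ n ≥ n₀, ∀ m s' : ℕ, m ≤ n → s' ≤ s → ¬ HasAlgDetRepr (perPoly (Fin n) ℂ) m s' := by
  obtain ⟨n₀, hgood⟩ := hW
  refine ⟨max n₀ 1, fun n hn m s' hm hs' hrep => ?_⟩
  exact not_hasAlgDetRepr_perPoly_self_of_localHessianBound (le_of_max_le_right hn) (hH n)
    (hgood n (le_of_max_le_left hn)) (Nat.lt_succ_self s) le_rfl (hrep.mono hm hs')

end Reduction

end Summit.ValiantsHypothesis.ValiantsHypothesis.Theorems.GrenetZeonPolySizeQPAlgebra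

end
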